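import Mathlib.Analysis.SpecificLimits.Basic
import Mathlib.MeasureTheory.Integral.DominatedConvergence
import Mathlib.MeasureTheory.Integral.Prod
import Literature.Dynamics.Ergodic.BirkhoffErgodicTheoremProofs
import Summits.AnomalousDissipation.AnomalousDissipation.Theorems.BaireTransferDenseLoudDesignerForcesErgodicLine

/-!
# Stub 3a `stub_birkhoffMeans` of the line `ergodic-budget-selection-closing`
# (crux `BaireTransfer.DenseLoudDesignerForces`, stmt-AnomalousDissipation-1143)

Sorry-free discharge of the registered stub `stub_birkhoffMeans` of the lead's skeleton
(`Cruxes/DenseLoudDesignerForces/Lines/ergodic-budget-selection-closing.lean`) over the landed line vocabulary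
`Theorems/BaireTransferDenseLoudDesignerForcesErgodicLine.lean` (namespace `…Theorems.DenseLoudDesignerForces.Ergodic`:
`Hsp`, `rep`, `enstrophyObs`, `energyAvg`, `dissipAvg`, `IsNSPhase`, `IsInvariantMeasure`).

**Statement.**  For an NS phase `(K, φ)` (compact forward-invariant `K ⊂ H`, jointly continuous semiflow, finite
and continuous enstrophy on `K`) and an invariant Borel probability measure `μ` carried by `K`, the trajectory
time means of the energy `T⁻¹ ∫₀ᵀ ‖φ_t x‖² dt` and of the dissipation `T⁻¹ ∫₀ᵀ ν‖∇φ_t x‖² dt` converge for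
`μ`-a.e. `x`, as the REAL time `T → ∞`, to measurable integrable limits `En ≥ 0`, `D` whose space means are the
ensemble budgets `ensembleEnergy μ = ∫ ‖u‖² dμ` and `ensembleDissipation ν μ = ν (∫⁻ ‖∇u‖² dμ).toReal`.
No ergodicity and no PDE is used: this is pure ergodic theory of the semiflow.

**Proof.**  (i) `K.piecewise (φ 1) id` is a Borel measurable modification of the time-one map preserving `μ`
(`stub_birkhoffMeans_aux_measurePreserving`); on `K` its iterates are `φ n` (`…_iterate`).  (ii) For an
observable `obs` continuous on `K` put `g y = ∫₀¹ obs (φ_s y) ds`; it is continuous on `K`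
(`…_continuousOn_avg`, parametric integral of a jointly continuous integrand over the compact `K`), hence
`μ`-integrable, its Birkhoff sums are `∫₀ⁿ obs (φ_t x) dt` (`…_birkhoffSum`), and `∫ g dμ = ∫ obs dμ` by Fubini
and invariance (`…_integral_avg`).  (iii) The tree's pointwise ergodic theorem
`Literature.Dynamics.Ergodic.ae_tendsto_birkhoffAverage_condExp` (Birkhoff 1931; Dajani–Kalle Thm 3.1.1) gives
a.e. convergence of `n⁻¹ ∫₀ⁿ` to `G = E[g | invariant σ-algebra]`, measurable with `∫ G = ∫ g`; boundedness of
`obs` on `K` upgrades integer to real times (`…_tendsto_of_nat`).  (iv) Apply this to `obs = ‖·‖²` and to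
`enstrophyObs`, identify `∫ enstrophyObs dμ = (ensembleEnstrophy μ).toReal` (`…_integral_enstrophyObs`), take
`En = max G₁ 0` (an a.e. modification) and `D = ν G₂`.

References: G. D. Birkhoff, PNAS 17 (1931) 656–660; K. Dajani, C. Kalle, *A First Course in Ergodic Theory*
(CRC 2021) Thm 3.1.1 and the Exercise after it (flows); Foias–Manley–Rosa–Temam, *Navier–Stokes Equations and
Turbulence* (CUP 2001) Ch. IV §2, Ch. V §1 (time vs ensemble averages of invariant measures).
-/

set_option linter.dupNamespace false

noncomputable section

open scoped BigOperators Topology ENNReal InnerProductSpace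
open Filter Set Function MeasureTheory

namespace Summit.AnomalousDissipation.AnomalousDissipation.Theorems.DenseLoudDesignerForces.Ergodic

open Literature.Analysis.FunctionSpaces Literature.Analysis.FunctionSpaces.Torus
open Literature.Analysis.FluidPDE Literature.Analysis.FluidPDE.Torus
open Summit.AnomalousDissipation.AnomalousDissipation.Theses.BaireTransfer
open Summit.AnomalousDissipation.AnomalousDissipation.Theorems.DenseLoudDesignerForces.Negative

/-! ## Birkhoff means of the energy and the dissipation along the semiflow (stub 3a of the line)

Continuous-time Birkhoff theorem for the NS phase `(K, φ)` with an invariant probability measure `μ` carried by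
`K`: apply the tree's discrete pointwise ergodic theorem (`ae_tendsto_birkhoffAverage_condExp`) to the
measurable modification `K.piecewise (φ 1) id` of the time-one map and to the observable
`y ↦ ∫₀¹ obs (φ_s y) ds`, then pass from integer to real times (the observables are bounded on the compact `K`). -/

section BirkhoffMeans

variable {ν : ℝ} {F : (UnitAddTorus (Fin 3)) → (EuclideanSpace ℝ (Fin 3))} {K : Set Hsp} {φ : ℝ → Hsp → Hsp}
  {μ : Measure Hsp}

/-- Along a trajectory starting in `K`, an observable continuous on `K` is a continuous function of the time
`t ≥ 0`. [folklore] -/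
theorem stub_birkhoffMeans_aux_orbit_continuousOn (hK : IsNSPhase ν F K φ) {obs : Hsp → ℝ}
    (hobs : ContinuousOn obs K) {x : Hsp} (hx : x ∈ K) :
    ContinuousOn (fun t : ℝ => obs (φ t x)) (Ici 0) := by
  have h0 : Continuous fun t : ℝ => ((t, x) : ℝ × Hsp) := by fun_prop
  have h1 : ContinuousOn (fun t : ℝ => φ t x) (Ici 0) :=
    hK.continuousOn.comp h0.continuousOn fun t ht => ⟨ht, hx⟩
  exact hobs.comp h1 fun t ht => hK.mapsTo t ht hx

/-- Interval integrability of `t ↦ obs (φ_t x)` on `[a, b] ⊆ [0, ∞)` for `x ∈ K`. [folklore] -/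
theorem stub_birkhoffMeans_aux_intervalIntegrable (hK : IsNSPhase ν F K φ) {obs : Hsp → ℝ}
    (hobs : ContinuousOn obs K) {x : Hsp} (hx : x ∈ K) {a b : ℝ} (ha : 0 ≤ a) (hab : a ≤ b) :
    IntervalIntegrable (fun t : ℝ => obs (φ t x)) volume a b := by
  refine ContinuousOn.intervalIntegrable ?_
  rw [uIcc_of_le hab]
  exact (stub_birkhoffMeans_aux_orbit_continuousOn hK hobs hx).mono fun t ht => ha.trans ht.1

/-- A function continuous on the compact carrier `K` of the probability measure `μ` is `μ`-integrable.
[folklore] -/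
theorem stub_birkhoffMeans_aux_integrable (hK : IsNSPhase ν F K φ) (hμ : IsInvariantMeasure K φ μ)
    {g : Hsp → ℝ} (hg : ContinuousOn g K) : Integrable g μ := by
  haveI := hμ.prob
  have hKm : MeasurableSet K := hK.isCompact.isClosed.measurableSet
  have hres : μ.restrict K = μ := Measure.restrict_eq_self_of_ae_mem hμ.ae_mem
  obtain ⟨C, hC⟩ := hK.isCompact.exists_bound_of_continuousOn hg
  have h1 : AEStronglyMeasurable g μ := by
    rw [← hres]
    exact hg.aestronglyMeasurable hKm
  exact Integrable.of_bound h1 C (hμ.ae_mem.mono fun x hx => hC x hx)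

/-- A measurable, measure-preserving modification of the time-one map: `K.piecewise (φ 1) id` agrees with
`φ 1` on `K` (hence `μ`-a.e.), is Borel measurable, and pushes `μ` to itself. [folklore] -/
theorem stub_birkhoffMeans_aux_measurePreserving (hK : IsNSPhase ν F K φ) (hμ : IsInvariantMeasure K φ μ) :
    ∃ f : Hsp → Hsp, MeasurePreserving f μ μ ∧ ∀ y ∈ K, f y = φ 1 y := by
  classical
  have hKm : MeasurableSet K := hK.isCompact.isClosed.measurableSet
  have h0 : Continuous fun y : Hsp => (((1 : ℝ), y) : ℝ × Hsp) := by fun_prop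
  have hc1 : ContinuousOn (φ 1) K :=
    hK.continuousOn.comp h0.continuousOn fun y hy => ⟨zero_le_one (α := ℝ), hy⟩
  have hae : K.piecewise (φ 1) id =ᵐ[μ] φ 1 :=
    hμ.ae_mem.mono fun y hy => piecewise_eq_of_mem _ _ _ hy
  refine ⟨K.piecewise (φ 1) id, ⟨hc1.measurable_piecewise continuousOn_id hKm, ?_⟩,
    fun y hy => piecewise_eq_of_mem _ _ _ hy⟩
  rw [Measure.map_congr hae, hμ.map_eq 1 zero_le_one]

/-- On `K` the iterates of (a modification of) the time-one map are the integer-time maps of the semiflow.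
[folklore] -/
theorem stub_birkhoffMeans_aux_iterate (hK : IsNSPhase ν F K φ) {f : Hsp → Hsp}
    (hf : ∀ y ∈ K, f y = φ 1 y) {x : Hsp} (hx : x ∈ K) (k : ℕ) : f^[k] x = φ k x := by
  induction k with
  | zero => simp [hK.map_zero x hx]
  | succ k ih =>
    rw [Function.iterate_succ_apply', ih, hf _ (hK.mapsTo k k.cast_nonneg hx), Nat.cast_succ,
      add_comm, hK.map_add 1 k zero_le_one k.cast_nonneg x hx]

/-- The Birkhoff sums of `y ↦ ∫₀¹ obs (φ_s y) ds` along the time-one map are the time integrals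
`∫₀ⁿ obs (φ_t x) dt` (semigroup law and additivity of the integral over `[k, k+1]`). [folklore] -/
theorem stub_birkhoffMeans_aux_birkhoffSum (hK : IsNSPhase ν F K φ) {obs : Hsp → ℝ}
    (hobs : ContinuousOn obs K) {f : Hsp → Hsp} (hf : ∀ y ∈ K, f y = φ 1 y) {x : Hsp} (hx : x ∈ K)
    (n : ℕ) :
    birkhoffSum f (fun y => ∫ s in (0 : ℝ)..1, obs (φ s y)) n x = ∫ t in (0 : ℝ)..n, obs (φ t x) := by
  have hk : ∀ k : ℕ, (∫ s in (0 : ℝ)..1, obs (φ s (f^[k] x))) =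
      ∫ t in ((k : ℕ) : ℝ)..((k + 1 : ℕ) : ℝ), obs (φ t x) := by
    intro k
    rw [stub_birkhoffMeans_aux_iterate hK hf hx k]
    have h1 : ∫ s in (0 : ℝ)..1, obs (φ s (φ k x)) = ∫ s in (0 : ℝ)..1, obs (φ (s + k) x) := by
      refine intervalIntegral.integral_congr fun s hs => ?_
      rw [uIcc_of_le zero_le_one] at hs
      show obs (φ s (φ k x)) = obs (φ (s + k) x)
      rw [hK.map_add s k hs.1 k.cast_nonneg x hx]
    rw [h1, intervalIntegral.integral_comp_add_right (fun t => obs (φ t x)) (k : ℝ), zero_add,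
      Nat.cast_succ, add_comm (k : ℝ) 1]
  unfold birkhoffSum
  simp_rw [hk]
  rw [intervalIntegral.sum_integral_adjacent_intervals (a := fun k : ℕ => (k : ℝ))
    fun k _ => stub_birkhoffMeans_aux_intervalIntegrable hK hobs hx (Nat.cast_nonneg k)
      (by exact_mod_cast (Nat.le_succ k))]
  simp

/-- From integer to real times: if `h` is bounded and locally integrable on `[0, ∞)` and the means
`n⁻¹ ∫₀ⁿ h` converge to `L` along `n : ℕ`, then `T⁻¹ ∫₀ᵀ h → L` as the real time `T → ∞` (the tail
`T⁻¹ ∫_{⌊T⌋}^{T} h` is `O(1/T)` and `⌊T⌋ / T → 1`). [folklore] -/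
theorem stub_birkhoffMeans_aux_tendsto_of_nat {h : ℝ → ℝ} {M L : ℝ} (hM : ∀ t, 0 ≤ t → ‖h t‖ ≤ M)
    (hint : ∀ a b : ℝ, 0 ≤ a → a ≤ b → IntervalIntegrable h volume a b)
    (hlim : Tendsto (fun n : ℕ => (n : ℝ)⁻¹ * ∫ t in (0 : ℝ)..n, h t) atTop (𝓝 L)) :
    Tendsto (fun T : ℝ => T⁻¹ * ∫ t in (0 : ℝ)..T, h t) atTop (𝓝 L) := by
  -- main term
  have h1 : Tendsto (fun T : ℝ => (⌊T⌋₊ : ℝ) / T * ((⌊T⌋₊ : ℝ)⁻¹ * ∫ t in (0 : ℝ)..(⌊T⌋₊ : ℝ), h t))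
      atTop (𝓝 (1 * L)) :=
    tendsto_nat_floor_div_atTop.mul (hlim.comp tendsto_nat_floor_atTop)
  rw [one_mul] at h1
  -- tail term
  have h2 : Tendsto (fun T : ℝ => T⁻¹ * ∫ t in (⌊T⌋₊ : ℝ)..T, h t) atTop (𝓝 0) := by
    have h3 : Tendsto (fun T : ℝ => M * T⁻¹) atTop (𝓝 0) := by
      simpa using tendsto_inv_atTop_zero.const_mul M
    refine squeeze_zero_norm' ?_ h3
    filter_upwards [eventually_gt_atTop (0 : ℝ)] with T hT
    have hfl : (⌊T⌋₊ : ℝ) ≤ T := Nat.floor_le hT.le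
    have hfl' : T < ⌊T⌋₊ + 1 := Nat.lt_floor_add_one T
    have hb : ∀ t ∈ uIoc (⌊T⌋₊ : ℝ) T, ‖h t‖ ≤ M := by
      intro t ht
      rw [uIoc_of_le hfl] at ht
      exact hM t ((Nat.cast_nonneg _).trans ht.1.le)
    rw [norm_mul, norm_inv, Real.norm_of_nonneg hT.le, mul_comm]
    refine mul_le_mul_of_nonneg_right ?_ (inv_nonneg.2 hT.le)
    calc ‖∫ t in (⌊T⌋₊ : ℝ)..T, h t‖ ≤ M * |T - ⌊T⌋₊| :=
          intervalIntegral.norm_integral_le_of_norm_le_const hb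
      _ ≤ M * 1 := by
          refine mul_le_mul_of_nonneg_left ?_ ((norm_nonneg _).trans (hM 0 le_rfl))
          rw [abs_le]
          constructor <;> linarith
      _ = M := mul_one M
  -- combine
  have h4 := h1.add h2
  rw [add_zero] at h4
  refine h4.congr' ?_
  filter_upwards [eventually_ge_atTop (1 : ℝ)] with T hT
  have hT0 : (0 : ℝ) ≤ T := zero_le_one.trans hT
  have hn0 : (⌊T⌋₊ : ℝ) ≠ 0 := Nat.cast_ne_zero.2 (Nat.floor_pos.2 hT).ne'
  have hfl : (⌊T⌋₊ : ℝ) ≤ T := Nat.floor_le hT0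
  rw [← intervalIntegral.integral_add_adjacent_intervals (hint 0 _ le_rfl (Nat.cast_nonneg ⌊T⌋₊))
    (hint _ T (Nat.cast_nonneg ⌊T⌋₊) hfl), mul_add]
  congr 1
  rw [div_eq_mul_inv, mul_comm (⌊T⌋₊ : ℝ) T⁻¹, mul_assoc, ← mul_assoc (⌊T⌋₊ : ℝ), mul_inv_cancel₀ hn0,
    one_mul]

/-- The observable `y ↦ ∫₀¹ obs (φ_s y) ds` is continuous on `K` (joint continuity of the semiflow on the
compact `[0, 1] × K`; parametric interval integrals of a jointly continuous integrand are continuous).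
[folklore] -/
theorem stub_birkhoffMeans_aux_continuousOn_avg (hK : IsNSPhase ν F K φ) {obs : Hsp → ℝ}
    (hobs : ContinuousOn obs K) :
    ContinuousOn (fun y => ∫ s in (0 : ℝ)..1, obs (φ s y)) K := by
  have hc : Continuous fun p : ↥K × ℝ => obs (φ (max p.2 0) (p.1 : Hsp)) := by
    have h1 : Continuous fun p : ↥K × ℝ => ((max p.2 0, (p.1 : Hsp)) : ℝ × Hsp) := by fun_prop
    have h2 : ∀ p : ↥K × ℝ, ((max p.2 0, (p.1 : Hsp)) : ℝ × Hsp) ∈ Ici (0 : ℝ) ×ˢ K :=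
      fun p => mk_mem_prod (mem_Ici.2 (le_max_right _ _)) p.1.2
    have h3 : Continuous fun p : ↥K × ℝ => φ (max p.2 0) (p.1 : Hsp) :=
      hK.continuousOn.comp_continuous h1 h2
    exact hobs.comp_continuous h3 fun p => hK.mapsTo _ (le_max_right _ _) p.1.2
  have hg : Continuous fun p : ↥K => ∫ s in (0 : ℝ)..1, obs (φ (max s 0) (p : Hsp)) :=
    intervalIntegral.continuous_parametric_intervalIntegral_of_continuous'
      (f := fun (p : ↥K) (s : ℝ) => obs (φ (max s 0) (p : Hsp))) hc 0 1
  rw [continuousOn_iff_continuous_restrict]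
  refine hg.congr fun p => ?_
  rw [restrict_apply]
  refine intervalIntegral.integral_congr fun s hs => ?_
  rw [uIcc_of_le zero_le_one] at hs
  simp only [max_eq_left hs.1]

/-- Space mean of the observable `y ↦ ∫₀¹ obs (φ_s y) ds`: by Fubini and the invariance `(φ_s)_* μ = μ` it is
`∫ obs dμ`. [folklore] -/
theorem stub_birkhoffMeans_aux_integral_avg (hK : IsNSPhase ν F K φ) (hμ : IsInvariantMeasure K φ μ)
    {obs : Hsp → ℝ} (hobs : ContinuousOn obs K) :
    ∫ y, (∫ s in (0 : ℝ)..1, obs (φ s y)) ∂μ = ∫ y, obs y ∂μ := by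
  haveI := hμ.prob
  -- short-circuit the instance search (`SFinite μ` on `Hsp` otherwise times out through `Countable Hsp`)
  haveI : SigmaFinite μ := IsFiniteMeasure.toSigmaFinite μ
  haveI : SFinite μ := instSFiniteOfSigmaFinite
  have hKm : MeasurableSet K := hK.isCompact.isClosed.measurableSet
  have hres : μ.restrict K = μ := Measure.restrict_eq_self_of_ae_mem hμ.ae_mem
  obtain ⟨C, hC⟩ := hK.isCompact.exists_bound_of_continuousOn hobs
  -- the integrand is bounded and continuous on `Ioc 0 1 × K`, which carries the product measure
  have hE : ((volume : Measure ℝ).restrict (Ioc (0 : ℝ) 1)).prod μ =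
      ((volume : Measure ℝ).prod μ).restrict (Ioc (0 : ℝ) 1 ×ˢ K) := by
    have h := Measure.prod_restrict (μ := (volume : Measure ℝ)) (ν := μ) (Ioc (0 : ℝ) 1) K
    rwa [hres] at h
  have hsm : MeasurableSet (Ioc (0 : ℝ) 1 ×ˢ K) := measurableSet_Ioc.prod hKm
  have hcont : ContinuousOn (uncurry fun (s : ℝ) (y : Hsp) => obs (φ s y)) (Ioc (0 : ℝ) 1 ×ˢ K) := by
    have h1 : ContinuousOn (fun q : ℝ × Hsp => φ q.1 q.2) (Ioc (0 : ℝ) 1 ×ˢ K) :=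
      hK.continuousOn.mono (prod_mono (fun s hs => hs.1.le) Subset.rfl)
    exact hobs.comp h1 fun q hq => hK.mapsTo q.1 hq.1.1.le hq.2
  have hint : Integrable (uncurry fun (s : ℝ) (y : Hsp) => obs (φ s y))
      (((volume : Measure ℝ).restrict (uIoc (0 : ℝ) 1)).prod μ) := by
    rw [uIoc_of_le zero_le_one]
    have hm : AEStronglyMeasurable (uncurry fun (s : ℝ) (y : Hsp) => obs (φ s y))
        (((volume : Measure ℝ).restrict (Ioc (0 : ℝ) 1)).prod μ) := by
      rw [hE]
      exact hcont.aestronglyMeasurable hsm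
    have hb : ∀ᵐ q ∂((volume : Measure ℝ).prod μ).restrict (Ioc (0 : ℝ) 1 ×ˢ K), q ∈ Ioc (0 : ℝ) 1 ×ˢ K :=
      ae_restrict_mem hsm
    rw [← hE] at hb
    refine Integrable.of_bound hm C ?_
    filter_upwards [hb] with q hq
    exact hC _ (hK.mapsTo q.1 hq.1.1.le hq.2)
  rw [← intervalIntegral_integral_swap hint]
  have hs : EqOn (fun s : ℝ => ∫ y, obs (φ s y) ∂μ) (fun _ => ∫ y, obs y ∂μ) (uIcc (0 : ℝ) 1) := by
    intro s hs
    rw [uIcc_of_le zero_le_one] at hs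
    have hae : AEMeasurable (φ s) μ := by
      by_contra h
      have h0 := Measure.map_of_not_aemeasurable h
      rw [hμ.map_eq s hs.1] at h0
      exact IsProbabilityMeasure.ne_zero μ h0
    have hom : AEStronglyMeasurable obs (Measure.map (φ s) μ) := by
      rw [hμ.map_eq s hs.1, ← hres]
      exact hobs.aestronglyMeasurable hKm
    have h2 := integral_map hae hom
    rw [hμ.map_eq s hs.1] at h2
    exact h2.symm
  rw [intervalIntegral.integral_congr hs, intervalIntegral.integral_const]
  simp

/-- **Birkhoff means of one observable.**  For `obs` continuous on `K` there is a Borel measurable,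
`μ`-integrable `G` (the conditional expectation of `y ↦ ∫₀¹ obs (φ_s y) ds` on the invariant σ-algebra of
the time-one map) with `∫ G dμ = ∫ obs dμ` and `T⁻¹ ∫₀ᵀ obs (φ_t x) dt → G x` for `μ`-a.e. `x`
(pointwise ergodic theorem for the time-one map, then integer-to-real times).
[cite: DajaniKalle2021, Thm 3.1.1] -/
theorem stub_birkhoffMeans_aux_observable (hK : IsNSPhase ν F K φ) (hμ : IsInvariantMeasure K φ μ)
    {obs : Hsp → ℝ} (hobs : ContinuousOn obs K) :
    ∃ G : Hsp → ℝ, Measurable G ∧ Integrable G μ ∧ ∫ x, G x ∂μ = ∫ x, obs x ∂μ ∧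
      ∀ᵐ x ∂μ, Tendsto (fun T : ℝ => T⁻¹ * ∫ t in (0 : ℝ)..T, obs (φ t x)) atTop (𝓝 (G x)) := by
  haveI := hμ.prob
  obtain ⟨f, hf, hfK⟩ := stub_birkhoffMeans_aux_measurePreserving hK hμ
  obtain ⟨C, hC⟩ := hK.isCompact.exists_bound_of_continuousOn hobs
  have hgi : Integrable (fun y => ∫ s in (0 : ℝ)..1, obs (φ s y)) μ :=
    stub_birkhoffMeans_aux_integrable hK hμ (stub_birkhoffMeans_aux_continuousOn_avg hK hobs)
  have hGm : Measurable[MeasurableSpace.invariants f]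
      (μ[fun y => ∫ s in (0 : ℝ)..1, obs (φ s y)|MeasurableSpace.invariants f]) :=
    stronglyMeasurable_condExp.measurable
  refine ⟨μ[fun y => ∫ s in (0 : ℝ)..1, obs (φ s y)|MeasurableSpace.invariants f],
    hGm.mono (MeasurableSpace.invariants_le f) le_rfl, integrable_condExp,
    (integral_condExp (MeasurableSpace.invariants_le f)).trans
      (stub_birkhoffMeans_aux_integral_avg hK hμ hobs), ?_⟩
  filter_upwards [Literature.Dynamics.Ergodic.ae_tendsto_birkhoffAverage_condExp hf hgi, hμ.ae_mem]
    with x hx hxK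
  have h2 : Tendsto (fun n : ℕ => (n : ℝ)⁻¹ * ∫ t in (0 : ℝ)..n, obs (φ t x)) atTop
      (𝓝 ((μ[fun y => ∫ s in (0 : ℝ)..1, obs (φ s y)|MeasurableSpace.invariants f]) x)) := by
    refine hx.congr fun n => ?_
    rw [birkhoffAverage, stub_birkhoffMeans_aux_birkhoffSum hK hobs hfK hxK n, smul_eq_mul]
  exact stub_birkhoffMeans_aux_tendsto_of_nat (fun t ht => hC _ (hK.mapsTo t ht hxK))
    (fun a b ha hab => stub_birkhoffMeans_aux_intervalIntegrable hK hobs hxK ha hab) h2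

/-- The ensemble enstrophy of an invariant measure carried by `K` is the Bochner integral of the (finite,
continuous on `K`) enstrophy observable. [folklore] -/
theorem stub_birkhoffMeans_aux_integral_enstrophyObs (hK : IsNSPhase ν F K φ)
    (hμ : IsInvariantMeasure K φ μ) : ∫ y, enstrophyObs y ∂μ = (ensembleEnstrophy μ).toReal := by
  haveI := hμ.prob
  have hKm : MeasurableSet K := hK.isCompact.isClosed.measurableSet
  have hres : μ.restrict K = μ := Measure.restrict_eq_self_of_ae_mem hμ.ae_mem
  have hcont : ContinuousOn (fun y : Hsp => eGradNormSq (rep y)) K := by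
    refine (ENNReal.continuous_ofReal.comp_continuousOn hK.enstrophy_continuousOn).congr
      fun y hy => ?_
    simp only [comp_apply, enstrophyObs]
    rw [ENNReal.ofReal_toReal (hK.enstrophy_finite y hy)]
  have hae : AEMeasurable (fun y : Hsp => eGradNormSq (rep y)) μ := by
    rw [← hres]
    exact hcont.aemeasurable hKm
  have hfin : ∀ᵐ y ∂μ, eGradNormSq (rep y) < ∞ :=
    hμ.ae_mem.mono fun y hy => lt_top_iff_ne_top.2 (hK.enstrophy_finite y hy)
  exact integral_toReal hae hfin

/-- **Stub 3a of the line `ergodic-budget-selection-closing`: Birkhoff means of energy and dissipation.**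
For an NS phase `(K, φ)` with an invariant probability measure `μ` carried by `K`, there are Borel measurable,
`μ`-integrable functions `En ≥ 0` and `D` with `∫ En dμ = ensembleEnergy μ`, `∫ D dμ = ensembleDissipation ν μ`,
such that for `μ`-a.e. `x` the trajectory time means of the energy `‖φ_t x‖²` and of the dissipation
`ν ‖∇φ_t x‖²` converge to `En x` and `D x` as `T → ∞` (Birkhoff's pointwise ergodic theorem for the
time-one map applied to `∫₀¹ obs ∘ φ_s ds`, Fubini and invariance for the space means; no ergodicity).
[cite: DajaniKalle2021, Thm 3.1.1] -/
theorem stub_birkhoffMeans {ν : ℝ} {F : (UnitAddTorus (Fin 3)) → (EuclideanSpace ℝ (Fin 3))} {K : Set Hsp} {φ : ℝ → Hsp → Hsp} {μ : Measure Hsp} (hK : IsNSPhase ν F K φ) (hμ : IsInvariantMeasure K φ μ) : ∃ En D : Hsp → ℝ, Measurable En ∧ Measurable D ∧ (∀ x, 0 ≤ En x) ∧ Integrable En μ ∧ Integrable D μ ∧ ∫ x, En x ∂μ = ensembleEnergy μ ∧ ∫ x, D x ∂μ = ensembleDissipation ν μ ∧ ∀ᵐ x ∂μ, Tendsto (energyAvg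 φ x) atTop (𝓝 (En x)) ∧ Tendsto (dissipAvg ν φ x) atTop (𝓝 (D x)) := by
  haveI := hμ.prob
  have hobs₁ : ContinuousOn (fun y : Hsp => ‖y‖ ^ 2) K := (continuous_norm.pow 2).continuousOn
  obtain ⟨G₁, hG₁m, hG₁i, hG₁I, hG₁lim⟩ := stub_birkhoffMeans_aux_observable hK hμ hobs₁
  obtain ⟨G₂, hG₂m, hG₂i, hG₂I, hG₂lim⟩ :=
    stub_birkhoffMeans_aux_observable hK hμ hK.enstrophy_continuousOn
  have hG₁nn : ∀ᵐ x ∂μ, 0 ≤ G₁ x := by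
    filter_upwards [hG₁lim] with x hx
    refine ge_of_tendsto hx ?_
    filter_upwards [eventually_ge_atTop (0 : ℝ)] with T hT
    exact mul_nonneg (inv_nonneg.2 hT) (intervalIntegral.integral_nonneg hT fun t _ => sq_nonneg _)
  have hEn : (fun x => max (G₁ x) 0) =ᵐ[μ] G₁ := hG₁nn.mono fun x hx => max_eq_left hx
  refine ⟨fun x => max (G₁ x) 0, fun x => ν * G₂ x, hG₁m.max measurable_const, hG₂m.const_mul ν,
    fun x => le_max_right _ _, hG₁i.pos_part, hG₂i.const_mul ν, ?_, ?_, ?_⟩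
  · rw [integral_congr_ae hEn, hG₁I]
    rfl
  · rw [integral_const_mul, hG₂I, stub_birkhoffMeans_aux_integral_enstrophyObs hK hμ]
    rfl
  · filter_upwards [hG₁lim, hG₂lim, hEn] with x h1 h2 h3
    refine ⟨?_, ?_⟩
    · show Tendsto (fun T : ℝ => T⁻¹ * ∫ t in (0 : ℝ)..T, ‖φ t x‖ ^ 2) atTop (𝓝 (max (G₁ x) 0))
      rw [h3]
      exact h1
    · have h4 : dissipAvg ν φ x = fun T : ℝ => ν * (T⁻¹ * ∫ t in (0 : ℝ)..T, enstrophyObs (φ t x)) := by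
        funext T
        simp only [dissipAvg, intervalIntegral.integral_const_mul]
        ring
      rw [h4]
      exact h2.const_mul ν

end BirkhoffMeans

end Summit.AnomalousDissipation.AnomalousDissipation.Theorems.DenseLoudDesignerForces.Ergodic

end
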